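import Mathlib

/-!
# SoloBlind: Descartes' bound for `1 + f g` is attained by two binomials

For `t`-sparse real polynomials `f, g` the polynomial `1 + f g` has at most
`t_f t_g + 1` monomials, hence at most `t_f t_g` positive roots (Descartes).
Chattopadhyay's question (the `s = 3` case of the SOS-τ conjecture of
Dutta–Saxena–Thierauf) asks whether the number of real roots of `1 + f g`
is in fact linear in `t_f + t_g`.  This file records the kernel-checked
data point that for `t_f = t_g = 2` the Descartes bound `4` is attained:
with `f = x - 1` and `g = 4x + 17x^{10}`,
`h(x) = 1 + f g = 1 - 4x + 4x^2 - 17x^{10} + 17x^{11} = (1-2x)^2 + 17x^{10}(x-1)`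
has four roots in `(0,1)` (sign pattern `+ - + - +` at `2/5, 1/2, 7/10, 17/20, 1`).
(For `t_f = 2` and every `t_g = t` the bound `2t` is attained by the scale-separated
family `1 + (x-1) Σ_j 3 m_j x^{m_j}`, `m_1 ≥ 8`, `m_{j+1} ≥ 40 m_j`; paper proof in the
solo-blind notes, WALL §2.4 (ζ).)
-/

namespace Summit.ValiantsHypothesis.SoloBlind

/-- `h(x) = 1 + f(x) g(x)` with the binomials `f = x - 1`, `g = 4x + 17x^10`. -/
noncomputable def fgPlusOne22 (x : ℝ) : ℝ := 1 + (x - 1) * (4 * x + 17 * x ^ 10)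

/-- `h` is continuous (a polynomial function). -/
theorem fgPlusOne22_continuous : Continuous fgPlusOne22 := by
  unfold fgPlusOne22
  fun_prop

/-- `h(2/5) > 0`. -/
theorem fgPlusOne22_pos_two_fifths : 0 < fgPlusOne22 (2 / 5) := by
  unfold fgPlusOne22; norm_num

/-- `h(1/2) = -17/2048 < 0`. -/
theorem fgPlusOne22_neg_half : fgPlusOne22 (1 / 2) < 0 := by
  unfold fgPlusOne22; norm_num

/-- `h(7/10) > 0`. -/
theorem fgPlusOne22_pos_seven_tenths : 0 < fgPlusOne22 (7 / 10) := by
  unfold fgPlusOne22; norm_num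

/-- `h(17/20) < 0`. -/
theorem fgPlusOne22_neg_seventeen_twentieths : fgPlusOne22 (17 / 20) < 0 := by
  unfold fgPlusOne22; norm_num

/-- `h(1) = 1 > 0`. -/
theorem fgPlusOne22_pos_one : 0 < fgPlusOne22 1 := by
  unfold fgPlusOne22; norm_num

/-- IVT: a sign change `+ → -` of `h` on `[a,b]` gives a root in `(a,b)`. -/
lemma fgPlusOne22_root_of_pos_neg {a b : ℝ} (hab : a ≤ b)
    (ha : 0 < fgPlusOne22 a) (hb : fgPlusOne22 b < 0) :
    ∃ x ∈ Set.Ioo a b, fgPlusOne22 x = 0 := by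
  have h := intermediate_value_Ioo' hab (fgPlusOne22_continuous.continuousOn)
  have h0 : (0 : ℝ) ∈ Set.Ioo (fgPlusOne22 b) (fgPlusOne22 a) := ⟨hb, ha⟩
  obtain ⟨x, hx, hx0⟩ := h h0
  exact ⟨x, hx, hx0⟩

/-- IVT: a sign change `- → +` of `h` on `[a,b]` gives a root in `(a,b)`. -/
lemma fgPlusOne22_root_of_neg_pos {a b : ℝ} (hab : a ≤ b)
    (ha : fgPlusOne22 a < 0) (hb : 0 < fgPlusOne22 b) :
    ∃ x ∈ Set.Ioo a b, fgPlusOne22 x = 0 := by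
  have h := intermediate_value_Ioo hab (fgPlusOne22_continuous.continuousOn)
  have h0 : (0 : ℝ) ∈ Set.Ioo (fgPlusOne22 a) (fgPlusOne22 b) := ⟨ha, hb⟩
  obtain ⟨x, hx, hx0⟩ := h h0
  exact ⟨x, hx, hx0⟩

/-- Descartes' bound `t_f · t_g = 4` on the positive roots of `1 + f g` is attained by two
binomials: `1 + (x-1)(4x + 17x^10)` has four distinct roots in `(0,1)`. -/
theorem fgPlusOne22_four_roots :
    ∃ x₁ x₂ x₃ x₄ : ℝ, 0 < x₁ ∧ x₁ < x₂ ∧ x₂ < x₃ ∧ x₃ < x₄ ∧ x₄ < 1 ∧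
      fgPlusOne22 x₁ = 0 ∧ fgPlusOne22 x₂ = 0 ∧ fgPlusOne22 x₃ = 0 ∧ fgPlusOne22 x₄ = 0 := by
  obtain ⟨x₁, ⟨h1a, h1b⟩, h1⟩ := fgPlusOne22_root_of_pos_neg (by norm_num : (2/5 : ℝ) ≤ 1/2)
    fgPlusOne22_pos_two_fifths fgPlusOne22_neg_half
  obtain ⟨x₂, ⟨h2a, h2b⟩, h2⟩ := fgPlusOne22_root_of_neg_pos (by norm_num : (1/2 : ℝ) ≤ 7/10)
    fgPlusOne22_neg_half fgPlusOne22_pos_seven_tenths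
  obtain ⟨x₃, ⟨h3a, h3b⟩, h3⟩ := fgPlusOne22_root_of_pos_neg (by norm_num : (7/10 : ℝ) ≤ 17/20)
    fgPlusOne22_pos_seven_tenths fgPlusOne22_neg_seventeen_twentieths
  obtain ⟨x₄, ⟨h4a, h4b⟩, h4⟩ := fgPlusOne22_root_of_neg_pos (by norm_num : (17/20 : ℝ) ≤ 1)
    fgPlusOne22_neg_seventeen_twentieths fgPlusOne22_pos_one
  refine ⟨x₁, x₂, x₃, x₄, by linarith, by linarith, by linarith, by linarith, h4b, h1, h2, h3, h4⟩

end Summit.ValiantsHypothesis.SoloBlind
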